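import Literature.Barriers.RiemannHypothesis.EpsteinZetaRealZerosDHEven
import Literature.Barriers.RiemannHypothesis.EpsteinZetaRealZerosDHPhase
import Literature.Barriers.RiemannHypothesis.DavenportHeilbronnSeries
import Mathlib.Analysis.Fourier.FiniteAbelian.PontryaginDuality
import HarnessLib

/-!
# Davenport–Heilbronn for Epstein zeta functions, XIII: inputs for the odd class number case —
# base-twist limits, character sums, character choice, and the local estimate of a real flip

Sibling of `Literature/Barriers/RiemannHypothesis/EpsteinZetaRealZeros.lean` (named fact
`DavenportHeilbronn1936b_epstein`). Everything in this file is PROVED; no definitions, no named facts.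

Davenport–Heilbronn II (`h(d) = 2N + 1` odd): §2 "We write `h(d) = 2N+1`, and denote by
`χ₁, …, χ_N` a set of `N` non-principal characters no two of which are reciprocal" (for odd `h` no
non-principal character is real, footnote †); §3 Lemma 1 (the determinant `|1 − ℜχ_k(γ_j)|` is
non-zero — the orthogonality of the real parts of the characters, "Multiplying (3) by `ψ(γ_i⁻¹)`
and summing over all characters `ψ`"); §5 (the base point `a(p) = 1` for `m ≤ n₀` and the control of
the second-order terms `|c₂{s, ν, p, a(p)}| < c₃`). For the tree's variant
(`EpsteinZetaRealZerosDHOdd.lean`) we supply: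

* `continuousOn_tsum_primeTerm`, `tendsto_logEuler_base`, `base_zero_limits`,
  `tsum_primeTerm_zero_eq_ofReal`, `tendsto_primeSumReal_atTop` — continuity and the limits at `1⁺`
  of the class-character series twisted by the base point `a(p) = i` (`= e^{iπ/2}`): `E_χ → ℓ_χ`
  (`χ ≠ χ₀`), `E_{χ₀}(s) = i D(s) + O(1)` with the real degree-one prime sum `D(s) → +∞`;
* `sum_re_toMulHom_mul_re` — **orthogonality of real parts**:
  `Σ_g ℜχ(g) ℜψ(g) = (h/2)([χ = ψ] + [χ = ψ̄])` (D–H II Lemma 1 in the form used);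
* `exists_addChar_re_ne_zero`, `exists_re_toMulHom_neg`, `ne_neg_of_ne_zero_of_odd` — a
  non-principal `χ*` with `ℜχ*(𝔎) ≠ 0`, a class `g₀` with `ℜχ*(g₀) < 0`, and `χ* ≠ χ̄*` for odd `h`;
* `re_locPair_estimate`, `boost_block_estimate` — for a real flip `a(p) = ±1 = e^{iβ}` of a split
  prime, `ℜ[ℓ(u x e^{iβ}) + ℓ(ū x e^{iβ}) − ℓ(u x i) − ℓ(ū x i)] = 2ℜu cos β · x + O(4x²)`
  (`ℓ(z) = −log(1 − z)`; D–H's `|c₂| < c₃`), summed over a block of primes of mass `Σ 1/p ≈ m`.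

## References

* [DavenportHeilbronn1936b] H. Davenport, H. Heilbronn, *On the zeros of certain Dirichlet
  series II*, J. London Math. Soc. 11 (1936), 307–312, §2, §3 Lemma 1, §5.
-/

noncomputable section

open Filter Topology Complex NumberField IsDedekindDomain Module Set
open Literature.NumberTheory.LFunctions Literature.NumberTheory.LFunctions.AbelianDensity
open scoped nonZeroDivisors ComplexConjugate Classical

namespace Literature.Barriers.RiemannHypothesis

namespace DHEpstein

variable {K : Type*} [Field K] [NumberField K]

/-! ## Continuity of the degree-one prime sums -/

/-- `s ↦ Σ_𝔭 [N𝔭 prime] a(𝔭) N𝔭^{-s}` is continuous on `s > 1` (`|a| ≤ 1`; locally uniform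
convergence). [folklore] -/
theorem continuousOn_tsum_primeTerm {a : HeightOneSpectrum (𝓞 K) → ℂ} (ha : ∀ v, ‖a v‖ ≤ 1) :
    ContinuousOn (fun s : ℝ ↦ ∑' v, primeTerm a s v) (Ioi 1) := by
  intro s₀ hs₀
  have hε : 1 < (1 + s₀) / 2 := by simp only [mem_Ioi] at hs₀; linarith
  have hcont : ContinuousOn (fun s : ℝ ↦ ∑' v, primeTerm a s v) (Ioi ((1 + s₀) / 2)) := by
    refine continuousOn_tsum (u := fun v ↦ npow v ((1 + s₀) / 2)) (fun v ↦ ?_) (summable_npow hε)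
      fun v s hs ↦ ?_
    · unfold primeTerm
      split_ifs
      · exact (continuous_zterm v).continuousOn
      · exact continuousOn_const
    · simp only [mem_Ioi] at hs
      unfold primeTerm
      split_ifs
      · exact (norm_zterm_le ha s v).trans (npow_le_npow_of_le v hs.le)
      · rw [norm_zero]; exact npow_nonneg v _
  have hmem : Ioi ((1 + s₀) / 2) ∈ 𝓝 s₀ := Ioi_mem_nhds (by simp only [mem_Ioi] at hs₀; linarith)
  exact (hcont.continuousAt hmem).continuousWithinAt

/-! ## The base twist `a(p) = i = e^{iπ/2}` and its limits -/

/-- `e^{iπ/2} = i`. [folklore] -/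
theorem cexp_pi_div_two_mul_I : cexp ((Real.pi / 2 : ℝ) * I) = I := by
  rw [Complex.exp_mul_I, ← Complex.ofReal_cos, ← Complex.ofReal_sin, Real.cos_pi_div_two,
    Real.sin_pi_div_two]
  simp

/-- `|complMul (p ↦ e^{iθ_p}) (n)| ≤ 1`. [folklore] -/
theorem norm_complMul_cexp_le (θ : ℕ → ℝ) : ∀ n, ‖complMul (fun p ↦ cexp (θ p * I)) n‖ ≤ 1 :=
  norm_complMul_le_one fun p _ ↦ by rw [Complex.norm_exp_ofReal_mul_I]

/-- For the base twist, the degree-one terms are `i` times those of the untwisted character: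
`[N𝔭 prime] χ([𝔭]) a(N𝔭) N𝔭^{-s} = i · [N𝔭 prime] χ([𝔭]) N𝔭^{-s}`. [folklore] -/
theorem primeTerm_twistCoeff_base (χ : AddChar (Additive (ClassGroup (𝓞 K))) ℂ) (s : ℝ)
    (v : HeightOneSpectrum (𝓞 K)) :
    primeTerm (twistCoeff χ (complMul fun _ ↦ cexp ((Real.pi / 2 : ℝ) * I))) s v =
      I * primeTerm (charCoeff ⊤ (primeClass (K := K)) χ) s v := by
  unfold primeTerm
  by_cases hp : (Ideal.absNorm v.asIdeal).Prime
  · simp only [if_pos hp]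
    unfold zterm twistCoeff
    rw [charCoeff_top, complMul_prime _ hp, cexp_pi_div_two_mul_I]
    ring
  · simp only [if_neg hp, mul_zero]

/-- **`E_χ → ℓ_χ` as `s → 1⁺` for `χ ≠ χ₀`** under the base twist `a(p) = i`
(`E_χ = i D_χ + remainder`, `D_χ` converges by `L(1, χ) ≠ 0`). [cite: DavenportHeilbronn1936b, §2] -/
theorem tendsto_logEuler_base (χ : AddChar (Additive (ClassGroup (𝓞 K))) ℂ) (hχ : χ ≠ 0) :
    ∃ ℓ : ℂ, Tendsto (fun s : ℝ ↦ logEuler (twistCoeff χ (complMul fun _ ↦ cexp ((Real.pi / 2 : ℝ) * I))) s)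
      (𝓝[>] 1) (𝓝 ℓ) := by
  set a₀ : ℕ → ℂ := ⇑(complMul fun _ ↦ cexp ((Real.pi / 2 : ℝ) * I)) with ha₀
  have hta : ∀ v, ‖twistCoeff χ a₀ v‖ ≤ 1 := norm_twistCoeff_le χ (norm_complMul_cexp_le _)
  obtain ⟨d, hd⟩ := tendsto_charPrimeSum χ hχ
  have hR := tendsto_tsum_remTerm hta
  refine ⟨I * d + ∑' v, remTerm (twistCoeff χ a₀) 1 v, ((hd.const_mul I).add hR).congr' ?_⟩
  filter_upwards [self_mem_nhdsWithin] with s hs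
  rw [logEuler_eq_add hta hs, ← tsum_mul_left]
  congr 1
  exact tsum_congr fun v ↦ (primeTerm_twistCoeff_base χ s v).symm

/-- **The principal character under the base twist**: `E_{χ₀}(s) − i D(s) → r₀` and
`D(s) + log(s − 1) → L₀` as `s → 1⁺`, `D(s) = Σ_{N𝔭 prime} N𝔭^{-s}` ("`M(s, χ₀)` has the pole
of `ζ_K`"). [cite: DavenportHeilbronn1936b, §2] -/
theorem base_zero_limits :
    ∃ r₀ : ℂ, ∃ L₀ : ℝ,
      Tendsto (fun s : ℝ ↦ logEuler (twistCoeff (0 : AddChar (Additive (ClassGroup (𝓞 K))) ℂ)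
        (complMul fun _ ↦ cexp ((Real.pi / 2 : ℝ) * I))) s -
        I * ∑' v, primeTerm (charCoeff ⊤ (primeClass (K := K)) 0) s v) (𝓝[>] 1) (𝓝 r₀) ∧
      Tendsto (fun s : ℝ ↦ (∑' v, primeTerm (charCoeff ⊤ (primeClass (K := K)) 0) s v) +
        (Real.log (s - 1) : ℂ)) (𝓝[>] 1) (𝓝 (L₀ : ℂ)) := by
  set a₀ : ℕ → ℂ := ⇑(complMul fun _ ↦ cexp ((Real.pi / 2 : ℝ) * I)) with ha₀
  have hta : ∀ v, ‖twistCoeff (0 : AddChar (Additive (ClassGroup (𝓞 K))) ℂ) a₀ v‖ ≤ 1 :=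
    norm_twistCoeff_le 0 (norm_complMul_cexp_le _)
  obtain ⟨L₀, hL₀⟩ := tendsto_charPrimeSum_zero_add_log (K := K)
  have hR := tendsto_tsum_remTerm hta
  refine ⟨_, L₀, hR.congr' ?_, hL₀⟩
  filter_upwards [self_mem_nhdsWithin] with s hs
  rw [logEuler_eq_add hta hs, ← tsum_mul_left, tsum_congr fun v ↦ (primeTerm_twistCoeff_base 0 s v).symm]
  ring

/-- The degree-one prime sum of the principal character is the real series
`Σ_{N𝔭 prime} N𝔭^{-s}`. [folklore] -/
theorem tsum_primeTerm_zero_eq_ofReal (s : ℝ) :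
    ∑' v, primeTerm (charCoeff ⊤ (primeClass (K := K)) 0) s v =
      Complex.ofReal (∑' v : HeightOneSpectrum (𝓞 K), if (Ideal.absNorm v.asIdeal).Prime then npow v s else 0) := by
  rw [Complex.ofReal_tsum]
  refine tsum_congr fun v ↦ ?_
  unfold primeTerm zterm
  rw [charCoeff_top, toMulHom_apply, AddChar.zero_apply, one_mul]
  split_ifs <;> simp

/-- The real degree-one prime sum is continuous on `s > 1`. [folklore] -/
theorem continuousOn_primeSumReal :
    ContinuousOn (fun s : ℝ ↦ ∑' v : HeightOneSpectrum (𝓞 K),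
      (if (Ideal.absNorm v.asIdeal).Prime then npow v s else 0 : ℝ)) (Ioi 1) := by
  have h := continuousOn_tsum_primeTerm (norm_charCoeff_le ⊤ (primeClass (K := K)) 0)
  have h2 := Complex.continuous_re.comp_continuousOn h
  refine h2.congr fun s _ ↦ ?_
  simp only [Function.comp_apply, tsum_primeTerm_zero_eq_ofReal, Complex.ofReal_re]

/-- **`D(s) = Σ_{N𝔭 prime} N𝔭^{-s} → +∞` as `s → 1⁺`.** [folklore] -/
theorem tendsto_primeSumReal_atTop :
    Tendsto (fun s : ℝ ↦ ∑' v : HeightOneSpectrum (𝓞 K),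
      (if (Ideal.absNorm v.asIdeal).Prime then npow v s else 0 : ℝ)) (𝓝[>] 1) atTop := by
  obtain ⟨r₀, L₀, -, hL⟩ := base_zero_limits (K := K)
  have hLr : Tendsto (fun s : ℝ ↦ (∑' v : HeightOneSpectrum (𝓞 K),
      (if (Ideal.absNorm v.asIdeal).Prime then npow v s else 0 : ℝ)) + Real.log (s - 1)) (𝓝[>] 1) (𝓝 L₀) := by
    have h := (Complex.continuous_re.tendsto _).comp hL
    simp only [Function.comp_def, Complex.ofReal_re] at h
    refine h.congr' ?_
    filter_upwards with s
    rw [tsum_primeTerm_zero_eq_ofReal, add_re, Complex.ofReal_re, Complex.ofReal_re]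
  have hlog : Tendsto (fun s : ℝ ↦ -Real.log (s - 1)) (𝓝[>] 1) atTop := by
    have h1 : Tendsto (fun s : ℝ ↦ s - 1) (𝓝[>] 1) (𝓝[>] 0) := by
      refine tendsto_nhdsWithin_iff.2 ⟨?_, ?_⟩
      · have := ((continuous_sub_right (1 : ℝ)).tendsto (1 : ℝ))
        simp only [sub_self] at this
        exact this.mono_left nhdsWithin_le_nhds
      · filter_upwards [self_mem_nhdsWithin] with s hs
        exact Set.mem_Ioi.2 (by simp only [Set.mem_Ioi] at hs; linarith)
    have h2 : Tendsto (fun s : ℝ ↦ Real.log (s - 1)) (𝓝[>] 1) atBot := Real.tendsto_log_nhdsGT_zero.comp h1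
    exact tendsto_neg_atBot_atTop.comp h2
  have h := hLr.add_atTop hlog
  refine h.congr' ?_
  filter_upwards with s
  ring

/-! ## Character sums over the class group -/

/-- `Σ_g χ(g) = h · [χ = 0]` over the class group. [folklore] -/
theorem sum_toMulHom_eq (χ : AddChar (Additive (ClassGroup (𝓞 K))) ℂ) :
    ∑ g : ClassGroup (𝓞 K), toMulHom χ g = if χ = 0 then (Nat.card (ClassGroup (𝓞 K)) : ℂ) else 0 := by
  have h1 : ∑ g : ClassGroup (𝓞 K), toMulHom χ g = ∑ a : Additive (ClassGroup (𝓞 K)), χ a :=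
    Fintype.sum_equiv Additive.ofMul _ _ fun g ↦ by rw [toMulHom_apply]
  rw [h1, AddChar.sum_eq_ite]
  have hcard : (Fintype.card (Additive (ClassGroup (𝓞 K))) : ℂ) = Nat.card (ClassGroup (𝓞 K)) := by
    rw [Nat.card_eq_fintype_card, Fintype.card_congr (Additive.toMul (α := ClassGroup (𝓞 K)))]
  rw [hcard]

/-- **Orthogonality of real parts** (D–H II Lemma 1 in the form used):
`Σ_g ℜχ(g) ℜψ(g) = (h/2)([χ = ψ] + [χ = ψ̄])` (`ℜa ℜb = ½ℜ(a b̄ + a b)` and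
`Σ_g (χψ̄)(g) = h[χ = ψ]`, `Σ_g (χψ)(g) = h[χ = ψ̄]`). [cite: DavenportHeilbronn1936b, §3 Lemma 1] -/
theorem sum_re_toMulHom_mul_re (χ ψ : AddChar (Additive (ClassGroup (𝓞 K))) ℂ) :
    ∑ g : ClassGroup (𝓞 K), (toMulHom χ g).re * (toMulHom ψ g).re =
      (Nat.card (ClassGroup (𝓞 K)) : ℝ) / 2 * ((if χ = ψ then 1 else 0) + (if χ = -ψ then 1 else 0)) := by
  have hterm : ∀ g : ClassGroup (𝓞 K), (toMulHom χ g).re * (toMulHom ψ g).re =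
      ((toMulHom (χ - ψ) g).re + (toMulHom (χ + ψ) g).re) / 2 := by
    intro g
    have e1 : toMulHom (χ - ψ) g = toMulHom χ g * conj (toMulHom ψ g) := by
      rw [conj_toMulHom, toMulHom_apply, toMulHom_apply, toMulHom_apply, sub_eq_add_neg, AddChar.add_apply]
    have e2 : toMulHom (χ + ψ) g = toMulHom χ g * toMulHom ψ g := by
      rw [toMulHom_apply, toMulHom_apply, toMulHom_apply, AddChar.add_apply]
    rw [e1, e2, mul_re, mul_re, Complex.conj_re, Complex.conj_im]
    ring
  simp only [hterm]
  rw [← Finset.sum_div, Finset.sum_add_distrib, ← Complex.re_sum, ← Complex.re_sum, sum_toMulHom_eq,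
    sum_toMulHom_eq]
  have E1 : (if χ - ψ = 0 then (Nat.card (ClassGroup (𝓞 K)) : ℂ) else 0) =
      if χ = ψ then (Nat.card (ClassGroup (𝓞 K)) : ℂ) else 0 := by simp only [sub_eq_zero]
  have E2 : (if χ + ψ = 0 then (Nat.card (ClassGroup (𝓞 K)) : ℂ) else 0) =
      if χ = -ψ then (Nat.card (ClassGroup (𝓞 K)) : ℂ) else 0 := by simp only [add_eq_zero_iff_eq_neg]
  rw [E1, E2]
  by_cases h1 : χ = ψ <;> by_cases h2 : χ = -ψ
  · rw [if_pos h1, if_pos h2, if_pos h1, if_pos h2, Complex.natCast_re]; ring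
  · rw [if_pos h1, if_neg h2, if_pos h1, if_neg h2, Complex.natCast_re, Complex.zero_re]; ring
  · rw [if_neg h1, if_pos h2, if_neg h1, if_pos h2, Complex.natCast_re, Complex.zero_re]; ring
  · rw [if_neg h1, if_neg h2, if_neg h1, if_neg h2, Complex.zero_re]; ring

/-- `Σ_g ℜχ(g) = h[χ = 0]`. [folklore] -/
theorem sum_re_toMulHom (χ : AddChar (Additive (ClassGroup (𝓞 K))) ℂ) :
    ∑ g : ClassGroup (𝓞 K), (toMulHom χ g).re = (Nat.card (ClassGroup (𝓞 K)) : ℝ) * (if χ = 0 then 1 else 0) := by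
  rw [← Complex.re_sum, sum_toMulHom_eq]
  split_ifs <;> simp

/-! ## Choice of the characters -/

/-- **A non-principal character with `ℜχ(𝔎) ≠ 0`** (`h > 1`): for `𝔎 = 1` any `χ ≠ χ₀`; else
`Σ_χ ℜχ(𝔎) = 0` with the term `χ₀` equal to `1`. [cite: DavenportHeilbronn1936b, §2] -/
theorem exists_addChar_re_ne_zero (hh : 1 < Nat.card (ClassGroup (𝓞 K))) (x : ClassGroup (𝓞 K)) :
    ∃ χ : AddChar (Additive (ClassGroup (𝓞 K))) ℂ, χ ≠ 0 ∧ (toMulHom χ x).re ≠ 0 := by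
  by_cases hx : x = 1
  · have hcard : 1 < Fintype.card (AddChar (Additive (ClassGroup (𝓞 K))) ℂ) := by
      rw [AddChar.card_eq, Fintype.card_congr Additive.ofMul.symm, Fintype.card_eq_nat_card]
      exact hh
    obtain ⟨χ, hχ⟩ := Fintype.exists_ne_of_one_lt_card hcard 0
    refine ⟨χ, hχ, ?_⟩
    rw [hx, map_one, Complex.one_re]
    exact one_ne_zero
  · have hsum := AddChar.sum_apply_eq_ite (α := Additive (ClassGroup (𝓞 K))) (Additive.ofMul x)
    have hx' : ¬ Additive.ofMul x = 0 := fun h ↦ hx (ofMul_eq_zero.1 h)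
    rw [if_neg hx'] at hsum
    have hre : ∑ χ : AddChar (Additive (ClassGroup (𝓞 K))) ℂ, (toMulHom χ x).re = 0 := by
      simp only [toMulHom_apply]
      rw [← Complex.re_sum, hsum, Complex.zero_re]
    rw [← Finset.add_sum_erase _ _ (Finset.mem_univ (0 : AddChar (Additive (ClassGroup (𝓞 K))) ℂ)),
      toMulHom_apply, AddChar.zero_apply, Complex.one_re] at hre
    have hlt : ∑ χ ∈ Finset.univ.erase (0 : AddChar (Additive (ClassGroup (𝓞 K))) ℂ), (toMulHom χ x).re <
        ∑ χ ∈ Finset.univ.erase (0 : AddChar (Additive (ClassGroup (𝓞 K))) ℂ), (0 : ℝ) := by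
      rw [Finset.sum_const_zero]; linarith
    obtain ⟨χ, hχ, hlt'⟩ := Finset.exists_lt_of_sum_lt hlt
    exact ⟨χ, Finset.ne_of_mem_erase hχ, hlt'.ne⟩

/-- **A class where a non-principal character has negative real part**: if `χ(g₁) = u ≠ 1`
then `Σ_{j<h} u^j = 0`, so `ℜu^j < 0` for some `j`, i.e. `ℜχ(g₁^j) < 0`.
[cite: DavenportHeilbronn1936b, §3] -/
theorem exists_re_toMulHom_neg {χ : AddChar (Additive (ClassGroup (𝓞 K))) ℂ} (hχ : χ ≠ 0) :
    ∃ g : ClassGroup (𝓞 K), (toMulHom χ g).re < 0 := by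
  obtain ⟨a, ha⟩ := AddChar.ne_one_iff.1 hχ
  set g₁ : ClassGroup (𝓞 K) := Additive.toMul a with hg₁
  set u : ℂ := toMulHom χ g₁ with hu
  have hu1 : u ≠ 1 := by rwa [hu, toMulHom_apply, hg₁, ofMul_toMul]
  set h := Nat.card (ClassGroup (𝓞 K)) with hh
  have hh0 : 0 < h := Nat.card_pos
  have hpow : u ^ h = 1 := by rw [hu, ← map_pow, pow_card_eq_one', map_one]
  have hgeom : ∑ j ∈ Finset.range h, u ^ j = 0 := by
    rw [geom_sum_eq hu1, hpow, sub_self, zero_div]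
  have hre : ∑ j ∈ Finset.range h, (u ^ j).re = 0 := by rw [← Complex.re_sum, hgeom, Complex.zero_re]
  rw [← Finset.add_sum_erase _ _ (Finset.mem_range.2 hh0), pow_zero, Complex.one_re] at hre
  have hlt : ∑ j ∈ (Finset.range h).erase 0, (u ^ j).re < ∑ j ∈ (Finset.range h).erase 0, (0 : ℝ) := by
    rw [Finset.sum_const_zero]; linarith
  obtain ⟨j, -, hj⟩ := Finset.exists_lt_of_sum_lt hlt
  refine ⟨g₁ ^ j, ?_⟩
  rwa [map_pow]

/-- For `h` odd a non-principal character is not real: `χ ≠ χ̄` (and `χ̄ ≠ χ₀`).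
[cite: DavenportHeilbronn1936b, §2 footnote] -/
theorem ne_neg_of_ne_zero_of_odd (hodd : Odd (Nat.card (ClassGroup (𝓞 K))))
    {χ : AddChar (Additive (ClassGroup (𝓞 K))) ℂ} (hχ : χ ≠ 0) : χ ≠ -χ ∧ -χ ≠ 0 := by
  refine ⟨fun h ↦ hχ ?_, fun h ↦ hχ (neg_eq_zero.1 h)⟩
  have h2 : (2 : ℕ) • χ = 0 := by rw [two_nsmul]; nth_rw 2 [h]; exact add_neg_cancel χ
  have hdvd : addOrderOf χ ∣ 2 := addOrderOf_dvd_of_nsmul_eq_zero h2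
  have hcard : addOrderOf χ ∣ Nat.card (ClassGroup (𝓞 K)) := by
    have := addOrderOf_dvd_card (x := χ)
    rwa [AddChar.card_eq, Fintype.card_congr Additive.ofMul.symm, Fintype.card_eq_nat_card] at this
  rcases (Nat.dvd_prime Nat.prime_two).1 hdvd with h1 | h1
  · exact AddMonoid.addOrderOf_eq_one_iff.1 h1
  · exfalso
    rw [h1] at hcard
    exact hodd.not_two_dvd_nat hcard

/-! ## The local estimate of a real flip -/

/-- `e^{iβ} = cos β` for `β ∈ {0, π}`. [folklore] -/
theorem cexp_mul_I_of_zero_or_pi {β : ℝ} (hβ : β = 0 ∨ β = Real.pi) : cexp (β * I) = (Real.cos β : ℂ) := by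
  rcases hβ with rfl | rfl
  · simp
  · rw [Complex.exp_pi_mul_I, Real.cos_pi]; simp

/-- For `|u| = 1`, `u + u⁻¹ = 2ℜu`. [folklore] -/
theorem add_inv_eq_two_mul_re {u : ℂ} (hu : ‖u‖ = 1) : u + u⁻¹ = (2 * u.re : ℝ) := by
  rw [Complex.inv_eq_conj hu, Complex.add_conj]

/-- **The local effect of a real flip** (D–H II §5: the second-order terms "`|c₂{s, ν, p, a(p)}| <
c₃`"): for `|u| = 1`, `0 ≤ x ≤ 1/2` and `β ∈ {0, π}`,
`|ℜ[ℓ(u x e^{iβ}) + ℓ(u⁻¹ x e^{iβ}) − ℓ(u x e^{iπ/2}) − ℓ(u⁻¹ x e^{iπ/2})] − 2ℜu · cos β · x| ≤ 4x²`,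
`ℓ(z) = −log(1 − z)` (`ℓ(z) = z + O(|z|²)`, `u + u⁻¹ = 2ℜu`, `ℜ(2ℜu · x i) = 0`).
[cite: DavenportHeilbronn1936b, §5] -/
theorem re_locPair_estimate {u : ℂ} (hu : ‖u‖ = 1) {x : ℝ} (hx0 : 0 ≤ x) (hx : x ≤ 1 / 2) {β : ℝ}
    (hβ : β = 0 ∨ β = Real.pi) :
    |(-Complex.log (1 - u * x * cexp (β * I)) + -Complex.log (1 - u⁻¹ * x * cexp (β * I)) -
        -Complex.log (1 - u * x * cexp ((Real.pi / 2 : ℝ) * I)) -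
        -Complex.log (1 - u⁻¹ * x * cexp ((Real.pi / 2 : ℝ) * I))).re - 2 * u.re * Real.cos β * x| ≤
      4 * x ^ 2 := by
  have hui : ‖u⁻¹‖ = 1 := by rw [norm_inv, hu, inv_one]
  -- the four small variables and their errors
  have key : ∀ {c : ℂ}, ‖c‖ = 1 → ∀ φ : ℝ, ∃ e : ℂ,
      -Complex.log (1 - c * x * cexp (φ * I)) = c * x * cexp (φ * I) + e ∧ ‖e‖ ≤ x ^ 2 := by
    intro c hc φ
    refine ⟨-Complex.log (1 - c * x * cexp (φ * I)) - c * x * cexp (φ * I), by ring, ?_⟩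
    have hz : ‖c * x * cexp (φ * I)‖ ≤ 1 / 2 := by rw [norm_mul_mul_cexp hc hx0]; exact hx
    have h := norm_log_one_sub_add_le hz
    rw [norm_mul_mul_cexp hc hx0] at h
    rwa [show -Complex.log (1 - c * x * cexp (φ * I)) - c * x * cexp (φ * I) =
      -(Complex.log (1 - c * x * cexp (φ * I)) + c * x * cexp (φ * I)) by ring, norm_neg]
  obtain ⟨e₁, h₁, n₁⟩ := key hu β
  obtain ⟨e₂, h₂, n₂⟩ := key hui β
  obtain ⟨e₃, h₃, n₃⟩ := key hu (Real.pi / 2)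
  obtain ⟨e₄, h₄, n₄⟩ := key hui (Real.pi / 2)
  rw [h₁, h₂, h₃, h₄, cexp_mul_I_of_zero_or_pi hβ, cexp_pi_div_two_mul_I]
  -- the main terms
  have hmain : (u * x * (Real.cos β : ℂ) + u⁻¹ * x * (Real.cos β : ℂ) - u * x * I - u⁻¹ * x * I).re =
      2 * u.re * Real.cos β * x := by
    have e : u * x * (Real.cos β : ℂ) + u⁻¹ * x * (Real.cos β : ℂ) - u * x * I - u⁻¹ * x * I =
        (u + u⁻¹) * x * Real.cos β - (u + u⁻¹) * x * I := by ring
    rw [e, add_inv_eq_two_mul_re hu]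
    simp only [sub_re, mul_re, mul_im, ofReal_re, ofReal_im, I_re, I_im, mul_zero, sub_zero, zero_mul,
      mul_one, add_zero]
    ring
  have e : (u * x * (Real.cos β : ℂ) + e₁ + (u⁻¹ * x * (Real.cos β : ℂ) + e₂) - (u * x * I + e₃) -
      (u⁻¹ * x * I + e₄)).re - 2 * u.re * Real.cos β * x = (e₁ + e₂ - e₃ - e₄).re := by
    rw [← hmain]; simp only [add_re, sub_re]; ring
  rw [e]
  calc |(e₁ + e₂ - e₃ - e₄).re| ≤ ‖e₁ + e₂ - e₃ - e₄‖ := abs_re_le_norm _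
    _ ≤ ‖e₁‖ + ‖e₂‖ + ‖e₃‖ + ‖e₄‖ :=
        (norm_sub_le _ _).trans (add_le_add ((norm_sub_le _ _).trans (add_le_add (norm_add_le _ _) le_rfl)) le_rfl)
    _ ≤ 4 * x ^ 2 := by linarith

/-- **A block of real flips**: for split primes `p > Y ≥ 1` collected in `S` with mass
`m ≤ Σ_{p∈S} 1/p ≤ m + 1/Y`, a unit `u`, and the flip `a(p) = e^{iβ} = ±1` with `cos β · m = t`,
`|Σ_{p∈S} ℜ[ℓ(u e^{iβ}/p) + ℓ(u⁻¹e^{iβ}/p) − ℓ(u i/p) − ℓ(u⁻¹ i/p)] − 2ℜu · t| ≤ (6 + 4m)/Y`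
(the second-order terms give `Σ 4/p² ≤ (4/Y) Σ 1/p`). [cite: DavenportHeilbronn1936b, §5] -/
theorem boost_block_estimate {u : ℂ} (hu : ‖u‖ = 1) {β : ℝ} (hβ : β = 0 ∨ β = Real.pi) {Y : ℕ}
    (hY : 1 ≤ Y) (S : Finset ℕ) (hS : ∀ p ∈ S, Y < p) {m t : ℝ} (ht : Real.cos β * m = t)
    (hmass : m ≤ ∑ p ∈ S, (1 / p : ℝ) ∧ ∑ p ∈ S, (1 / p : ℝ) ≤ m + 1 / Y) :
    |(∑ p ∈ S, (-Complex.log (1 - u * (1 / p : ℝ) * cexp (β * I)) +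
        -Complex.log (1 - u⁻¹ * (1 / p : ℝ) * cexp (β * I)) -
        -Complex.log (1 - u * (1 / p : ℝ) * cexp ((Real.pi / 2 : ℝ) * I)) -
        -Complex.log (1 - u⁻¹ * (1 / p : ℝ) * cexp ((Real.pi / 2 : ℝ) * I))).re) - 2 * u.re * t| ≤
      (6 + 4 * m) / Y := by
  have hY0 : (0 : ℝ) < Y := by exact_mod_cast hY
  have hY1 : (1 : ℝ) ≤ Y := by exact_mod_cast hY
  -- per prime
  have hp1 : ∀ p ∈ S, (0 : ℝ) ≤ 1 / p ∧ (1 / p : ℝ) ≤ 1 / 2 ∧ (1 / p : ℝ) ^ 2 ≤ (1 / Y) * (1 / p) := by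
    intro p hp
    have hYp : (Y : ℝ) < p := by exact_mod_cast hS p hp
    have hp0 : (0 : ℝ) < p := by linarith
    have hp2 : (2 : ℝ) ≤ p := by
      have : Y + 1 ≤ p := hS p hp
      have : (2 : ℕ) ≤ p := by omega
      exact_mod_cast this
    refine ⟨by positivity, ?_, ?_⟩
    · rw [div_le_div_iff₀ hp0 (by norm_num)]; linarith
    · rw [sq]
      have : (1 / p : ℝ) ≤ 1 / Y := one_div_le_one_div_of_le hY0 hYp.le
      exact mul_le_mul_of_nonneg_right this (by positivity)
  set f : ℕ → ℝ := fun p ↦ (-Complex.log (1 - u * (1 / p : ℝ) * cexp (β * I)) +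
        -Complex.log (1 - u⁻¹ * (1 / p : ℝ) * cexp (β * I)) -
        -Complex.log (1 - u * (1 / p : ℝ) * cexp ((Real.pi / 2 : ℝ) * I)) -
        -Complex.log (1 - u⁻¹ * (1 / p : ℝ) * cexp ((Real.pi / 2 : ℝ) * I))).re with hf
  have hterm : ∀ p ∈ S, |f p - 2 * u.re * Real.cos β * (1 / p : ℝ)| ≤ 4 * ((1 / Y) * (1 / p)) := by
    intro p hp
    obtain ⟨h0, h2, hsq⟩ := hp1 p hp
    exact (re_locPair_estimate hu h0 h2 hβ).trans (by linarith)
  have h1 : |∑ p ∈ S, f p - 2 * u.re * Real.cos β * ∑ p ∈ S, (1 / p : ℝ)| ≤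
      4 * (1 / Y) * ∑ p ∈ S, (1 / p : ℝ) := by
    rw [Finset.mul_sum, ← Finset.sum_sub_distrib, Finset.mul_sum]
    refine (Finset.abs_sum_le_sum_abs _ _).trans (Finset.sum_le_sum fun p hp ↦ ?_)
    exact (hterm p hp).trans (le_of_eq (by ring))
  -- the mass mismatch
  have hure : |u.re| ≤ 1 := by have := Complex.abs_re_le_norm u; rwa [hu] at this
  have hcos : |Real.cos β| ≤ 1 := Real.abs_cos_le_one β
  have hmis : |2 * u.re * Real.cos β * ∑ p ∈ S, (1 / p : ℝ) - 2 * u.re * t| ≤ 2 / Y := by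
    rw [← ht, show 2 * u.re * Real.cos β * ∑ p ∈ S, (1 / p : ℝ) - 2 * u.re * (Real.cos β * m) =
      2 * (u.re * Real.cos β) * (∑ p ∈ S, (1 / p : ℝ) - m) by ring, abs_mul, abs_mul]
    have h1' : |u.re * Real.cos β| ≤ 1 := by rw [abs_mul]; exact mul_le_one₀ hure (abs_nonneg _) hcos
    have h2' : |∑ p ∈ S, (1 / p : ℝ) - m| ≤ 1 / Y := by
      rw [abs_le]; constructor <;> linarith [hmass.1, hmass.2]
    calc |(2 : ℝ)| * |u.re * Real.cos β| * |∑ p ∈ S, (1 / p : ℝ) - m| ≤ 2 * 1 * (1 / Y) := by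
          rw [abs_two]; gcongr
      _ = 2 / Y := by ring
  have hY' : (1 : ℝ) / Y ≤ 1 := by rw [div_le_one hY0]; exact hY1
  have hmassY : 4 * (1 / Y) * ∑ p ∈ S, (1 / p : ℝ) ≤ (4 + 4 * m) / Y := by
    have : ∑ p ∈ S, (1 / p : ℝ) ≤ m + 1 := hmass.2.trans (by linarith)
    calc 4 * (1 / Y) * ∑ p ∈ S, (1 / p : ℝ) ≤ 4 * (1 / Y) * (m + 1) := by gcongr
      _ = (4 + 4 * m) / Y := by ring
  calc |∑ p ∈ S, f p - 2 * u.re * t|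
      ≤ |∑ p ∈ S, f p - 2 * u.re * Real.cos β * ∑ p ∈ S, (1 / p : ℝ)| +
          |2 * u.re * Real.cos β * ∑ p ∈ S, (1 / p : ℝ) - 2 * u.re * t| := abs_sub_le _ _ _
    _ ≤ 4 * (1 / Y) * ∑ p ∈ S, (1 / p : ℝ) + 2 / Y := add_le_add h1 hmis
    _ ≤ (4 + 4 * m) / Y + 2 / Y := by linarith
    _ = (6 + 4 * m) / Y := by ring

end DHEpstein

end Literature.Barriers.RiemannHypothesis
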